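import Summits.BirchSwinnertonDyer.BirchSwinnertonDyer.Theorems.ClassRecordThreeEulerHalvesAtThreeCartanTransportResidueMaps
import Summits.BirchSwinnertonDyer.BirchSwinnertonDyer.Theorems.ClassRecordThreeEulerHalvesAtThreeCartanCoverReduction
import HarnessLib

/-!
# (RED_ℓ) Residue maps of the cover order at good primes — PROVED

Support file for crux `CartanOnePlaceDegreeLawAtThree` (NUM; item stmt-BirchSwinnertonDyer-24801, line `lattice`), Galois leaf (OBS) via the inert-Hecke
certificate. The certificate's input (RED_ℓ) (`CartanCover.Charext.InertHecke.CoverResidueMapsAtGoodPrimes`, part D): for `q ∈ C` and a prime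
`ℓ ∤ q·D·M·∏_C p`, a ring map `red : O₀' → M₂(𝔽_ℓ)` on the cover order `O₀' = X.O + n_q·X.O₀` (`coverSubring X q`) with kernel `ℓ O₀'` and
`det ∘ red = nrd (mod ℓ)`. PROOF (this file, sorry-free, from bsd-idea-10 g17's brick H1 `…CartanTransportResidueMaps`): a residue model `ψ_ℓ` of the
Eichler hull `X.O₀` exists at every `ℓ ∤ D M` (`Residue.exists_isMatrixResidueMap_hull`: maximal order at a split prime + restriction to the hull of
index `M` prime to `ℓ`); it restricts to `O₀' ⊆ X.O₀` because `n_q·X.O₀ ⊆ O₀'` with `ℓ ∤ n_q = ∏_{C∖q} p` (`Residue.isMatrixResidueMap_of_le`, Bezout);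
the norm clause is `Residue.trace_det` (Cayley–Hamilton on both sides). Used by (T6) of the certificate: the `ℙ¹(𝔽_ℓ)`-identification of the `ℓ + 1`
cover cosets through kernel lines of the reduced representatives. Nothing here is specific to a curve; BSD is proved for no curve.
-/

set_option linter.dupNamespace false
set_option autoImplicit false

noncomputable section

namespace Summit.BirchSwinnertonDyer.BirchSwinnertonDyer.Theorems.CartanCover.Charext.InertHecke

open Literature.NumberTheory.Automorphic Summit.BirchSwinnertonDyer.BirchSwinnertonDyer.Theorems

/-- **(RED_ℓ) PROVED — residue maps of the cover order at good primes.** For a Cartan datum `X` of level `(D, M; C)`, `q ∈ C` and a prime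
`ℓ ∤ q·D·M·∏_C p`, there is a ring homomorphism `red : coverSubring X q →+* M₂(ZMod ℓ)` with kernel `ℓ·O₀'` and `det (red x) = nrd x (mod ℓ)`
(the body of `CoverResidueMapsAtGoodPrimes`; `q ∈ C` is not even needed). Proof: restrict a residue model of the Eichler hull (brick H1) to `O₀'`, of index dividing a
power of `n_q = ∏_{C∖q} p`, prime to `ℓ`. [cite: VignerasLNM800, Ch. II §2 Thm. 2.3 (1) and Ch. III §5 Prop. 5.1] [cite: Voight2021, Lemma 23.2.3] -/
theorem exists_coverResidueMap_of_not_dvd {D M : ℕ} {C : Finset ℕ} (X : CartanLevelCurveData D M C) (q : ℕ)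
    {ℓ : ℕ} (hℓ : ℓ.Prime) (hℓbad : ¬ ℓ ∣ q * (D * M * ∏ p ∈ C, p)) :
    ∃ red : CartanCover.coverSubring X q →+* Matrix (Fin 2) (Fin 2) (ZMod ℓ),
      (∀ x : CartanCover.coverSubring X q, red x = 0 ↔ ∃ y ∈ CartanCover.coverOrder X q, (x : X.B) = (ℓ : ℤ) • y) ∧
      (∀ x : CartanCover.coverSubring X q, ∃ n : ℤ, reducedNorm ℚ X.B (x : X.B) = n ∧ (red x).det = (n : ZMod ℓ)) := by
  classical
  haveI : Fact ℓ.Prime := ⟨hℓ⟩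
  have hℓDM : ¬ ℓ ∣ D * M := fun h => hℓbad (dvd_mul_of_dvd_right (dvd_mul_of_dvd_left h _) q)
  have hℓC : ¬ ℓ ∣ ∏ p ∈ C, p := fun h => hℓbad (dvd_mul_of_dvd_right (dvd_mul_of_dvd_right h _) q)
  have hℓn : ¬ ℓ ∣ CartanCover.coverIndex C q := fun h =>
    hℓC (h.trans (Finset.prod_dvd_prod_of_subset (C.erase q) C (fun p : ℕ => p) (Finset.erase_subset q C)))
  obtain ⟨ψ, hψ⟩ := CartanTransport.Residue.exists_isMatrixResidueMap_hull X hℓDM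
  have hψ' : IsMatrixResidueMap (CartanCover.coverOrder X q) ℓ ψ :=
    CartanTransport.Residue.isMatrixResidueMap_of_le hψ (CartanCover.coverOrder_le X q) (N := CartanCover.coverIndex C q)
      (fun x hx => CartanCover.smul_mem_coverOrder X q hx) (hℓ.coprime_iff_not_dvd.mpr hℓn)
  refine ⟨{ toFun := fun x => ψ x
            map_one' := hψ'.map_one
            map_mul' := fun x y => hψ'.map_mul _ x.2 _ y.2
            map_zero' := hψ'.map_zero
            map_add' := fun x y => hψ'.map_add _ x.2 _ y.2 }, fun x => hψ'.ker x x.2, fun x => ?_⟩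
  obtain ⟨-, n, -, hn, -, hdet⟩ := CartanTransport.Residue.trace_det hψ' (CartanCover.isOrder_coverOrder X q) x.2
  exact ⟨n, hn, hdet⟩

end Summit.BirchSwinnertonDyer.BirchSwinnertonDyer.Theorems.CartanCover.Charext.InertHecke

end
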